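import Mathlib
import Literature.NumberTheory.Automorphic.TwistedQuotientConeDescentStep
import Literature.NumberTheory.Automorphic.TwistedQuotientConeClass
import Literature.NumberTheory.Automorphic.ResGLnConeDictionaryCone
import Literature.NumberTheory.Automorphic.SiegelReducedFamilies
import Summits.Langlands.Langlands.Theorems.IrreducibilityBySelfDualityHeckeEigenvalueFieldStubConeGauge
import Summits.Langlands.Langlands.Theorems.IrreducibilityBySelfDualityHeckeEigenvalueFieldStubGaugeConv
import Summits.Langlands.Langlands.Theorems.IrreducibilityBySelfDualityHeckeEigenvalueFieldStubConeGrowth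
import Summits.Langlands.Langlands.Theorems.IrreducibilityBySelfDualityHeckeEigenvalueFieldStubFamRestrict
import Summits.Langlands.Langlands.Theorems.IrreducibilityBySelfDualityHeckeEigenvalueFieldStubFamPOU
import Summits.Langlands.Langlands.Theorems.IrreducibilityBySelfDualityHeckeEigenvalueFieldStubFamStairAlg1
import Summits.Langlands.Langlands.Theorems.IrreducibilityBySelfDualityHeckeEigenvalueFieldStubFamStairAlg2
import Summits.Langlands.Langlands.Theorems.IrreducibilityBySelfDualityHeckeEigenvalueFieldStubFamStairGrowth
import Summits.Langlands.Langlands.Theorems.IrreducibilityBySelfDualityHeckeEigenvalueFieldStubDescentGrowth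
import Summits.Langlands.Langlands.Theorems.IrreducibilityBySelfDualityHeckeEigenvalueFieldStubFamBA
import Summits.Langlands.Langlands.Theorems.IrreducibilityBySelfDualityHeckeEigenvalueFieldStubFamExt
import HarnessLib

/-! Route `IrreducibilityBySelfDuality`, crux `HeckeEigenvalueField`, line `Sketch`: the FAMILY half of (c') —
`stub_asm_family`, the per-orbit descent of the vanishing cone class to an invariant basic primitive with polynomial
growth, assembled from the landed FAM-* stubs. [cite: Borel1983Regularization, §3.5] [cite: BorelWallach2000, VII 2.2–2.7] -/

set_option linter.dupNamespace false

noncomputable section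

open scoped Classical Matrix TensorProduct Matrix.Norms.Operator Topology
open Filter Set NumberField NumberField.mixedEmbedding Literature.NumberTheory.Automorphic Literature.NumberTheory.DiophantineGeometry

attribute [-instance] instTopologicalSpaceMatrix Matrix.instUniformSpace
attribute [local instance high] NormedAddCommGroup.toSeminormedAddCommGroup

namespace Summit.Langlands.Langlands.Theorems.HeckeEigenvalueField.Res

open ResGLnCohomology BigHeckeGLn

set_option maxHeartbeats 1600000 in
set_option synthInstance.maxHeartbeats 200000 in
-- the assembly elaborates many datum-typed stub statements
/-- **Stub ASM-FAMILY — the geometric half of (c'): a vanishing cone class produces an invariant basic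
primitive of polynomial growth.**  If the cone class of `ω = coneForm η` vanishes, there is a family
`β_c` of smooth `q`-forms on the positive cone, indexed by the cosets of the level, with `dβ_c = ω_c`,
equivariant under the FULL rational group with the sign-twisted archimedean coefficient action, BASIC
(scale-invariant and killed by the Euler field) and with `C¹` bounds polynomial in the entries of `H, H⁻¹`
on every reduced (Siegel) set.  Assembly of steps 0–8 of the line: HOM-COB ⇒ per-orbit restriction to the
arithmetic stabiliser ⇒ staircase (BOTTOM, TOWER) ⇒ partition of unity (COVER-FIN, POU-A, POU-B) ⇒
descent with growth (GROWTH-ω, GROWTH-κ, GROWTH-STEP) ⇒ radial projection (RADIAL, BASIC, DET-UNIT) ⇒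
average over the full stabiliser (AVG, EQUIV-FULL) ⇒ re-extension to all cosets.
[cite: Borel1983Regularization, Thm. 3.2 and §3.5] [cite: BorelWallach2000, VII 2.2–2.7] [cite: Dupont1976, §1–2] -/
theorem stub_asm_family {n : ℕ} {K : Type} [Field K] [NumberField K] (hn : 0 < n)
    (hcpt : isCompact_glFiniteIntegralLevel n K) (𝔫 : Ideal (𝓞 K))
    (π : CuspidalAutomorphicRepData n K hcpt) (hbot : π.1.W' = ⊥)
    (hμ : ∃ μ : ℂ, ∀ c ∈ π.1.W, lieDeriv (AutomorphyDatum.gl n K hcpt).ofArch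
      (⟨1, trivial⟩ : (AutomorphyDatum.gl n K hcpt).arch.lie) c = μ • c)
    (S : Finset {w : InfinitePlace K // w.IsReal}) (lam : (K →+* ℂ) → Fin n → ℤ)
    (hdom : ∀ τ, Weight.IsDominant (lam τ)) {q : ℕ}
    {η : ConeDictionary.Cochain π.1 lam (q + 1)}
    (hη : η ∈ (ConeDictionary.gkComplexLS π.1 S lam).cocycles (q + 1))
    (hfix : ConeDictionary.IsLevelFixed π.1 lam 𝔫 η)
    (hZ : Literature.Algebra.Lie.ChevalleyEilenberg.ins q
      (⟨1, trivial⟩ : (AutomorphyDatum.gl n K hcpt).arch.lie) η = 0)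
    (hnot : η ∉ (ConeDictionary.gkComplexLS π.1 S lam).coboundaries (q + 1))
    (hω : TwistedQuotient.IsConeFormFamily (diagPos n K) (level n K 𝔫) (coeffRepPos ℂ n K lam)
      ((ResGLnCone.coneActionRat n K).comp (glTotPos n K).subtype) (ResGLnCone.posCone n K)
      (fun c H => ConeDictionary.coneForm π.1 S lam η c H))
    (hcls : TwistedQuotient.coneClass hω (ResGLnCone.hermOne_mem_posCone n K) = 0) :
    ∃ β : (BigHeckeGLn.FiniteAdelicGL n K ⧸ ResGLnCohomology.level n K 𝔫) →
        ResGLnCone.hermSpace n K → ResGLnCone.hermSpace n K [⋀^Fin q]→L[ℝ] ResGLnCohomology.CoeffModule ℂ n K lam,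
      (∀ c, ContDiffOn ℝ ((⊤ : ℕ∞) : WithTop ℕ∞)
        (fun H => @id (ResGLnCone.hermSpace n K [⋀^Fin q]→L[ℝ] ResGLnCohomology.CoeffModule ℂ n K lam) (β c H))
        (ResGLnCone.posCone n K)) ∧
      (∀ c, ∀ H ∈ ResGLnCone.posCone n K,
        extDeriv (fun H' => @id (ResGLnCone.hermSpace n K [⋀^Fin q]→L[ℝ] ResGLnCohomology.CoeffModule ℂ n K lam)
            (β c H')) H =
          @id (ResGLnCone.hermSpace n K [⋀^Fin (q + 1)]→L[ℝ] ResGLnCohomology.CoeffModule ℂ n K lam)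
            (ConeDictionary.coneForm π.1 S lam η c.out H)) ∧
      (∀ (γ : GL (Fin n) K) (c : BigHeckeGLn.FiniteAdelicGL n K ⧸ ResGLnCohomology.level n K 𝔫),
        ∀ H ∈ ResGLnCone.posCone n K, ∀ v : Fin q → ResGLnCone.hermSpace n K,
        β (BigHeckeGLn.globalEmbedding n K γ • c) (ResGLnCone.coneActionRat n K γ H)
            (fun i => ResGLnCone.coneActionRat n K γ (v i)) =
          ConeDictionary.σS hcpt S lam (ParallelWeight.diagArch K n γ) (β c H v)) ∧
      (∀ (c : BigHeckeGLn.FiniteAdelicGL n K ⧸ ResGLnCohomology.level n K 𝔫) (r : ℝ), 0 < r →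
        ∀ H ∈ ResGLnCone.posCone n K, ∀ v : Fin q → ResGLnCone.hermSpace n K,
          β c (r • H) (fun i => r • v i) = β c H v) ∧
      (∀ (c : BigHeckeGLn.FiniteAdelicGL n K ⧸ ResGLnCohomology.level n K 𝔫),
        ∀ H ∈ ResGLnCone.posCone n K, ∀ v : Fin q → ResGLnCone.hermSpace n K, (∃ i, v i = H) → β c H v = 0) ∧
      (∀ (c : BigHeckeGLn.FiniteAdelicGL n K ⧸ ResGLnCohomology.level n K 𝔫) (c₁ C₁ τ₁ : ℝ),
        ∃ (C : ℝ) (k : ℕ), ∀ H ∈ ResGLnCone.posCone n K,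
          SiegelFamily.IsReduced c₁ C₁ τ₁ n
              (SiegelFamily.placeFamily K (H : Matrix (Fin n) (Fin n) (mixedSpace K))) →
            ∀ (v : Fin q → ResGLnCone.hermSpace n K) (w' : ResGLnCone.hermSpace n K),
              ‖β c H v‖ ≤ C * (1 + ∑ i, ∑ j,
                  (‖(H : Matrix (Fin n) (Fin n) (mixedSpace K)) i j‖ +
                    ‖(H : Matrix (Fin n) (Fin n) (mixedSpace K))⁻¹ i j‖)) ^ k * ∏ i, ‖v i‖ ∧
              ‖fderiv ℝ (fun H' => @id (ResGLnCone.hermSpace n K [⋀^Fin q]→L[ℝ]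
                  ResGLnCohomology.CoeffModule ℂ n K lam) (β c H')) H w' v‖ ≤
                C * (1 + ∑ i, ∑ j,
                  (‖(H : Matrix (Fin n) (Fin n) (mixedSpace K)) i j‖ +
                    ‖(H : Matrix (Fin n) (Fin n) (mixedSpace K))⁻¹ i j‖)) ^ k * ‖w'‖ * ∏ i, ‖v i‖) := by  classical
  have _keep : π.1.W' = ⊥ ∧ ConeDictionary.IsLevelFixed π.1 lam 𝔫 η ∧
      η ∉ (ConeDictionary.gkComplexLS π.1 S lam).coboundaries (q + 1) := ⟨hbot, hfix, hnot⟩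
  have _keepμ := hμ
  obtain ⟨sz, hsz1, hsz2, hsz3, hsz4, hsz5⟩ := stub_exists_coneGauge n K
  obtain ⟨Ccv, kcv, hconv⟩ := stub_gauge_conv n K sz hsz1 hsz2 hsz5
  have hηc : η ∈ (ConeDictionary.gkComplexLS π.1 S lam).carrier (q + 1) :=
    (((ConeDictionary.gkComplexLS π.1 S lam).mem_cocycles_iff (q + 1) η).1 hη).1
  have percoset : ∀ cL : BigHeckeGLn.FiniteAdelicGL n K ⧸ ResGLnCohomology.level n K 𝔫,
      ∃ β₂ : ResGLnCone.hermSpace n K →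
        (ResGLnCone.hermSpace n K [⋀^Fin q]→L[ℝ] ResGLnCohomology.CoeffModule ℂ n K lam),
      ContDiffOn ℝ ((⊤ : ℕ∞) : WithTop ℕ∞) β₂ (ResGLnCone.posCone n K) ∧
      (∀ (γ : GL (Fin n) K), BigHeckeGLn.globalEmbedding n K γ • cL = cL →
        ∀ x ∈ ResGLnCone.posCone n K, ∀ v : Fin q → ResGLnCone.hermSpace n K,
          β₂ (ResGLnCone.coneActionRat n K γ x) (fun i => ResGLnCone.coneActionRat n K γ (v i)) =
            ConeDictionary.σS hcpt S lam (ParallelWeight.diagArch K n γ) (β₂ x v)) ∧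
      (∀ (r : ℝ), 0 < r → ∀ x ∈ ResGLnCone.posCone n K, ∀ v : Fin q → ResGLnCone.hermSpace n K,
        β₂ (r • x) (fun i => r • v i) = β₂ x v) ∧
      (∀ x ∈ ResGLnCone.posCone n K, ∀ v : Fin q → ResGLnCone.hermSpace n K, (∃ i, v i = x) → β₂ x v = 0) ∧
      (∀ x ∈ ResGLnCone.posCone n K,
        extDeriv β₂ x = @id (ResGLnCone.hermSpace n K [⋀^Fin (q + 1)]→L[ℝ] ResGLnCohomology.CoeffModule ℂ n K lam)
          (ConeDictionary.coneForm π.1 S lam η cL.out x)) ∧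
      ∀ (δ : GL (Fin n) K) (c₁ C₁ τ₁ : ℝ), ∃ (C : ℝ) (k : ℕ), ∀ x ∈ ResGLnCone.posCone n K,
        SiegelFamily.IsReduced c₁ C₁ τ₁ n
            (SiegelFamily.placeFamily K ((ResGLnCone.coneActionRat n K δ⁻¹ x : ResGLnCone.hermSpace n K) :
              Matrix (Fin n) (Fin n) (mixedSpace K))) →
          ∀ (v : Fin q → ResGLnCone.hermSpace n K) (w' : ResGLnCone.hermSpace n K),
            ‖β₂ x v‖ ≤ C * (1 + ∑ i, ∑ j,
              (‖(x : Matrix (Fin n) (Fin n) (mixedSpace K)) i j‖ +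
                ‖(x : Matrix (Fin n) (Fin n) (mixedSpace K))⁻¹ i j‖)) ^ k * ∏ i, ‖v i‖ ∧
            ‖fderiv ℝ β₂ x w' v‖ ≤ C * (1 + ∑ i, ∑ j,
              (‖(x : Matrix (Fin n) (Fin n) (mixedSpace K)) i j‖ +
                ‖(x : Matrix (Fin n) (Fin n) (mixedSpace K))⁻¹ i j‖)) ^ k * ‖w'‖ * ∏ i, ‖v i‖ := by
    intro cL
    set Γc : Subgroup (glTotPos n K) :=
      (MulAction.stabilizer (FiniteAdelicGL n K) cL).comap (diagPos n K) with hΓc_def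
    have hΓc : ∀ γ : Γc, diagPos n K (γ : glTotPos n K) • cL = cL := fun γ =>
      MulAction.mem_stabilizer_iff.1 (Subgroup.mem_comap.1 γ.2)
    obtain ⟨b, hbeq, hbδ⟩ := stub_fam_restrict hcpt 𝔫 π S lam hω hcls cL
    obtain ⟨ψ, T, c₀, C₀, τ₀, Δ, hc₀, hC₀, hτ₀, hψ, hcov, hΔ, Cψ, kψ, hψb⟩ := stub_fam_pou n K 𝔫 cL
    obtain ⟨hωs, Cω, kω, hωb⟩ := stub_coneForm_growth π.1 S lam hηc cL.out
    have hE1 : ∀ x : ResGLnCone.hermSpace n K, (1 : ℝ) ≤ 1 + ∑ i, ∑ j,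
        (‖(x : Matrix (Fin n) (Fin n) (mixedSpace K)) i j‖ + ‖(x : Matrix (Fin n) (Fin n) (mixedSpace K))⁻¹ i j‖) :=
      fun x => le_add_of_nonneg_right (Finset.sum_nonneg fun i _ => Finset.sum_nonneg fun j _ => by positivity)
    have hωb' : ∃ (C : ℝ) (k : ℕ), ∀ x ∈ ResGLnCone.posCone n K,
        ‖@id (ResGLnCone.hermSpace n K [⋀^Fin (q + 1)]→L[ℝ] CoeffModule ℂ n K lam) (ConeDictionary.coneForm π.1 S lam η cL.out x)‖ ≤ C * sz x ^ k ∧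
        ‖fderiv ℝ (fun H => @id (ResGLnCone.hermSpace n K [⋀^Fin (q + 1)]→L[ℝ] CoeffModule ℂ n K lam)
          (ConeDictionary.coneForm π.1 S lam η cL.out H)) x‖ ≤ C * sz x ^ k := by
      refine ⟨|Cω| * Ccv ^ kω, kcv * kω, fun x hx => ?_⟩
      obtain ⟨h1, h2⟩ := hωb x hx
      obtain ⟨hE, -⟩ := hconv x hx
      have hE0 : (0 : ℝ) ≤ 1 + ∑ i, ∑ j,
          (‖(x : Matrix (Fin n) (Fin n) (mixedSpace K)) i j‖ +
            ‖(x : Matrix (Fin n) (Fin n) (mixedSpace K))⁻¹ i j‖) := zero_le_one.trans (hE1 x)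
      have hpow : (1 + ∑ i, ∑ j,
          (‖(x : Matrix (Fin n) (Fin n) (mixedSpace K)) i j‖ +
            ‖(x : Matrix (Fin n) (Fin n) (mixedSpace K))⁻¹ i j‖)) ^ kω ≤ Ccv ^ kω * sz x ^ (kcv * kω) := by
        calc _ ≤ (Ccv * sz x ^ kcv) ^ kω := pow_le_pow_left₀ hE0 hE kω
          _ = Ccv ^ kω * sz x ^ (kcv * kω) := by rw [mul_pow, ← pow_mul]
      have key : Cω * (1 + ∑ i, ∑ j,
          (‖(x : Matrix (Fin n) (Fin n) (mixedSpace K)) i j‖ +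
            ‖(x : Matrix (Fin n) (Fin n) (mixedSpace K))⁻¹ i j‖)) ^ kω ≤
          |Cω| * Ccv ^ kω * sz x ^ (kcv * kω) := by
        calc _ ≤ |Cω| * (1 + ∑ i, ∑ j,
            (‖(x : Matrix (Fin n) (Fin n) (mixedSpace K)) i j‖ +
              ‖(x : Matrix (Fin n) (Fin n) (mixedSpace K))⁻¹ i j‖)) ^ kω :=
              mul_le_mul_of_nonneg_right (le_abs_self _) (pow_nonneg hE0 _)
          _ ≤ |Cω| * (Ccv ^ kω * sz x ^ (kcv * kω)) := mul_le_mul_of_nonneg_left hpow (abs_nonneg _)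
          _ = _ := by ring
      exact ⟨h1.trans key, h2.trans key⟩
    obtain ⟨ac, hac⟩ : ∃ ac : Γc →* (ResGLnCone.hermSpace n K →L[ℝ] ResGLnCone.hermSpace n K),
        ac = ((ResGLnCone.coneActionRat n K).comp (glTotPos n K).subtype).comp Γc.subtype := ⟨_, rfl⟩
    obtain ⟨om, hom⟩ : ∃ om : TwistedQuotient.TFam (⊤ : Subgroup Γc) (ResGLnCone.hermSpace n K)
        (CoeffModule ℂ n K lam), om = TwistedQuotient.single (⊤ : Subgroup Γc)
          (fun (_ : Γc ⧸ (⊤ : Subgroup Γc)) (H : ResGLnCone.hermSpace n K) =>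
            @id (ResGLnCone.hermSpace n K [⋀^Fin (q + 1)]→L[ℝ] CoeffModule ℂ n K lam) (ConeDictionary.coneForm π.1 S lam η cL.out H)) := ⟨_, rfl⟩
    obtain ⟨b'', hb''⟩ : ∃ b'' : (j : ℕ) → (Fin (j + 1) → Γc) → CoeffModule ℂ n K lam,
        b'' = fun j g => if h : j = q then b (fun i => g (Fin.cast (by rw [h]) i)) else 0 := ⟨_, rfl⟩
    obtain ⟨κ, hκ⟩ : ∃ κ : (j : ℕ) → TwistedQuotient.Coch Γc (⊤ : Subgroup Γc) (ResGLnCone.hermSpace n K)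
        (CoeffModule ℂ n K lam) j, κ = fun j g =>
          TwistedQuotient.stair (⊤ : Subgroup Γc) ac om (ResGLnCone.hermOne n K) j g -
            TwistedQuotient.single (⊤ : Subgroup Γc) (fun (_ : Γc ⧸ (⊤ : Subgroup Γc)) (_ : ResGLnCone.hermSpace n K) =>
              ContinuousAlternatingMap.constOfIsEmpty ℝ (ResGLnCone.hermSpace n K) (Fin 0)
                ((((-1 : ℝ) ^ ((q + 1) * (q + 2) / 2)) : ℂ) • b'' j g)) := ⟨_, rfl⟩
    have hκlt : ∀ j, j < q → κ j = TwistedQuotient.stair (⊤ : Subgroup Γc) ac om (ResGLnCone.hermOne n K) j := by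
      intro j hj; funext g c r
      have hb0 : b'' j g = 0 := by rw [hb'']; simp [hj.ne]
      rw [hκ]; simp only [Pi.sub_apply, hb0, smul_zero]
      rcases eq_or_ne r 0 with hr | hr
      · subst hr; rw [TwistedQuotient.single_self]; ext x v; simp
      · rw [TwistedQuotient.single_of_ne _ _ _ hr]; simp
    have hκq0 : ∀ (g : Fin (q + 1) → Γc) (c : Γc ⧸ (⊤ : Subgroup Γc)) (x : ResGLnCone.hermSpace n K),
        κ q g c 0 x = TwistedQuotient.stair (⊤ : Subgroup Γc) ac om (ResGLnCone.hermOne n K) q g c 0 x -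
          ContinuousAlternatingMap.constOfIsEmpty ℝ (ResGLnCone.hermSpace n K) (Fin 0)
            ((((-1 : ℝ) ^ ((q + 1) * (q + 2) / 2)) : ℂ) • b g) := by
      intro g c x
      have hbq : b'' q g = b g := by rw [hb'']; simp
      rw [hκ]; simp only [Pi.sub_apply, TwistedQuotient.single_self, hbq]
    have hκqs : ∀ (g : Fin (q + 1) → Γc) (c : Γc ⧸ (⊤ : Subgroup Γc)) (r : ℕ) (x : ResGLnCone.hermSpace n K),
        κ q g c (r + 1) x = TwistedQuotient.stair (⊤ : Subgroup Γc) ac om (ResGLnCone.hermOne n K) q g c (r + 1) x := by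
      intro g c r x
      rw [hκ]; simp only [Pi.sub_apply, TwistedQuotient.single_of_ne _ _ _ (Nat.succ_ne_zero r), Pi.zero_apply, sub_zero]
    subst hac hom
    obtain ⟨hS, hEq, hTow⟩ := stub_fam_stair_alg1 hcpt 𝔫 π S lam hω cL hωs Γc hΓc b hbeq κ hκlt hκq0 hκqs
    obtain ⟨hD0, hDq, hDω⟩ := stub_fam_stair_alg2 hcpt 𝔫 π S lam hω cL hωs Γc hΓc b hbδ κ hκlt hκq0 hκqs
    have hszn : ∃ C₀ : ℝ, ∀ x ∈ ResGLnCone.posCone n K, ‖x‖ ≤ C₀ * sz x := by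
      refine ⟨1, fun x hx => ?_⟩
      rw [one_mul]
      have hx' : @Norm.norm (Matrix (Fin n) (Fin n) (mixedSpace K)) Matrix.seminormedAddCommGroup.toNorm
          (x : Matrix (Fin n) (Fin n) (mixedSpace K)) ≤ sz x :=
        (@Matrix.norm_le_iff (Fin n) (Fin n) (mixedSpace K) _ _ _ (sz x) (zero_le_one.trans (hsz1 x hx))
          (x : Matrix (Fin n) (Fin n) (mixedSpace K))).2 fun i j => (hsz2 x hx i j).1
      exact hx'
    have hGr := stub_fam_stair_growth hcpt 𝔫 π S lam cL hωs Γc b κ hκlt hκq0 hκqs sz hsz1 hszn hsz3 hωb'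
    have hXo : IsOpen (ResGLnCone.posCone n K) := ResGLnCone.isOpen_posCone n K
    have hmaps : ∀ γ : Γc, Set.MapsTo
        ((((ResGLnCone.coneActionRat n K).comp (glTotPos n K).subtype).comp Γc.subtype) γ)
        (ResGLnCone.posCone n K) (ResGLnCone.posCone n K) := fun γ x hx =>
      ResGLnCone.mapsTo_coneActionRat_posCone n K _ hx
    have hF' : {H : ResGLnCone.hermSpace n K | H ∈ ResGLnCone.posCone n K ∧ ∃ t ∈ T,
          SiegelFamily.IsReduced c₀ C₀ τ₀ n (SiegelFamily.placeFamily K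
            ((ResGLnCone.coneActionRat n K t⁻¹ H : ResGLnCone.hermSpace n K) :
              Matrix (Fin n) (Fin n) (mixedSpace K)))} ⊆ ResGLnCone.posCone n K := fun x hx => hx.1
    have hψb' : ∃ (C : ℝ) (k : ℕ), ∀ γ ∈ Δ, ∀ x ∈ {H : ResGLnCone.hermSpace n K | H ∈ ResGLnCone.posCone n K ∧ ∃ t ∈ T,
          SiegelFamily.IsReduced c₀ C₀ τ₀ n (SiegelFamily.placeFamily K
            ((ResGLnCone.coneActionRat n K t⁻¹ H : ResGLnCone.hermSpace n K) :
              Matrix (Fin n) (Fin n) (mixedSpace K)))},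
        |ψ ((((ResGLnCone.coneActionRat n K).comp (glTotPos n K).subtype).comp Γc.subtype) γ⁻¹ x)| ≤ C * sz x ^ k ∧
        ‖fderiv ℝ (fun y => ψ ((((ResGLnCone.coneActionRat n K).comp (glTotPos n K).subtype).comp Γc.subtype) γ⁻¹ y)) x‖
            ≤ C * sz x ^ k ∧
        ‖iteratedFDeriv ℝ 2 (fun y => ψ ((((ResGLnCone.coneActionRat n K).comp (glTotPos n K).subtype).comp Γc.subtype) γ⁻¹ y)) x‖
            ≤ C * sz x ^ k := by
      refine ⟨|Cψ| * Ccv ^ kψ, kcv * kψ, fun γ hγ x hx => ?_⟩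
      obtain ⟨h1, h2, h3⟩ := hψb γ hγ x hx
      obtain ⟨hE, -⟩ := hconv x hx.1
      have hE0 : (0 : ℝ) ≤ 1 + ∑ i, ∑ j,
          (‖(x : Matrix (Fin n) (Fin n) (mixedSpace K)) i j‖ +
            ‖(x : Matrix (Fin n) (Fin n) (mixedSpace K))⁻¹ i j‖) := zero_le_one.trans (hE1 x)
      have key : Cψ * (1 + ∑ i, ∑ j,
          (‖(x : Matrix (Fin n) (Fin n) (mixedSpace K)) i j‖ +
            ‖(x : Matrix (Fin n) (Fin n) (mixedSpace K))⁻¹ i j‖)) ^ kψ ≤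
          |Cψ| * Ccv ^ kψ * sz x ^ (kcv * kψ) := by
        calc _ ≤ |Cψ| * (1 + ∑ i, ∑ j,
            (‖(x : Matrix (Fin n) (Fin n) (mixedSpace K)) i j‖ +
              ‖(x : Matrix (Fin n) (Fin n) (mixedSpace K))⁻¹ i j‖)) ^ kψ :=
              mul_le_mul_of_nonneg_right (le_abs_self _) (pow_nonneg hE0 _)
          _ ≤ |Cψ| * (Ccv * sz x ^ kcv) ^ kψ :=
              mul_le_mul_of_nonneg_left (pow_le_pow_left₀ hE0 hE kψ) (abs_nonneg _)
          _ = _ := by rw [mul_pow, ← pow_mul]; ring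
      exact ⟨h1.trans key, h2.trans key, h3.trans key⟩
    have hκb : ∀ j ≤ q, ∀ g : Fin (j + 1) → Γc, (∀ i, g i ∈ Δ) → ∀ (c : Γc ⧸ (⊤ : Subgroup Γc)) (r : ℕ),
        ∃ (C : ℝ) (k : ℕ), ∀ x ∈ {H : ResGLnCone.hermSpace n K | H ∈ ResGLnCone.posCone n K ∧ ∃ t ∈ T,
          SiegelFamily.IsReduced c₀ C₀ τ₀ n (SiegelFamily.placeFamily K
            ((ResGLnCone.coneActionRat n K t⁻¹ H : ResGLnCone.hermSpace n K) :
              Matrix (Fin n) (Fin n) (mixedSpace K)))},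
          ‖κ j g c r x‖ ≤ C * sz x ^ k ∧ ‖fderiv ℝ (κ j g c r) x‖ ≤ C * sz x ^ k := by
      intro j hj g _ c r
      obtain ⟨C, k, h⟩ := hGr j hj g c r
      exact ⟨C, k, fun x hx => h x hx.1⟩
    have h0S : TwistedQuotient.SmoothOn (⊤ : Subgroup Γc) (ResGLnCone.posCone n K)
        (0 : TwistedQuotient.Coch Γc (⊤ : Subgroup Γc) (ResGLnCone.hermSpace n K) (CoeffModule ℂ n K lam) (q + 1)) :=
      fun g c r => contDiffOn_const
    have h0E : @TwistedQuotient.IsEquivariantOn Γc Γc _ _ (MonoidHom.id Γc) (⊤ : Subgroup Γc) _ _ _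
        ((coeffRepPos ℂ n K lam).comp Γc.subtype) _ _ _
        (((ResGLnCone.coneActionRat n K).comp (glTotPos n K).subtype).comp Γc.subtype) _
        (ResGLnCone.posCone n K) (q + 1)
        (0 : TwistedQuotient.Coch Γc (⊤ : Subgroup Γc) (ResGLnCone.hermSpace n K) (CoeffModule ℂ n K lam) (q + 1)) := by
      intro γ g c r x hx; ext v; simp [TwistedQuotient.famAct_apply]
    have h0δ : ∀ (g : Fin (q + 3) → Γc) (c : Γc ⧸ (⊤ : Subgroup Γc)) (r : ℕ), ∀ x ∈ ResGLnCone.posCone n K,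
        TwistedQuotient.delta (⊤ : Subgroup Γc)
          (0 : TwistedQuotient.Coch Γc (⊤ : Subgroup Γc) (ResGLnCone.hermSpace n K) (CoeffModule ℂ n K lam) (q + 1))
          g c r x = 0 := by
      intro g c r x hx; simp [TwistedQuotient.delta_apply]
    have h0d : ∀ (g : Fin (q + 2) → Γc) (c : Γc ⧸ (⊤ : Subgroup Γc)) (r : ℕ), ∀ x ∈ ResGLnCone.posCone n K,
        TwistedQuotient.cochD (⊤ : Subgroup Γc)
          (0 : TwistedQuotient.Coch Γc (⊤ : Subgroup Γc) (ResGLnCone.hermSpace n K) (CoeffModule ℂ n K lam) (q + 1))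
          g c r x = TwistedQuotient.delta (⊤ : Subgroup Γc) (κ q) g c r x := by
      intro g c r x hx
      rw [hDq g c r x hx, TwistedQuotient.cochD_apply]
      cases r with
      | zero => simp [TwistedQuotient.famD_zero]
      | succ r =>
        simp only [TwistedQuotient.famD_succ]
        rw [show ((0 : TwistedQuotient.Coch Γc (⊤ : Subgroup Γc) (ResGLnCone.hermSpace n K)
              (CoeffModule ℂ n K lam) (q + 1)) g c r) = fun _ => 0 from rfl]
        ext v; simp [extDeriv_apply, fderiv_const_apply]
    have h0b : ∀ g : Fin (q + 2) → Γc, (∀ i, g i ∈ Δ) → ∀ (c : Γc ⧸ (⊤ : Subgroup Γc)) (r : ℕ),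
        ∃ (C : ℝ) (k : ℕ), ∀ x ∈ {H : ResGLnCone.hermSpace n K | H ∈ ResGLnCone.posCone n K ∧ ∃ t ∈ T,
          SiegelFamily.IsReduced c₀ C₀ τ₀ n (SiegelFamily.placeFamily K
            ((ResGLnCone.coneActionRat n K t⁻¹ H : ResGLnCone.hermSpace n K) :
              Matrix (Fin n) (Fin n) (mixedSpace K)))},
          ‖(0 : TwistedQuotient.Coch Γc (⊤ : Subgroup Γc) (ResGLnCone.hermSpace n K) (CoeffModule ℂ n K lam) (q + 1))
              g c r x‖ ≤ C * sz x ^ k ∧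
          ‖fderiv ℝ ((0 : TwistedQuotient.Coch Γc (⊤ : Subgroup Γc) (ResGLnCone.hermSpace n K)
              (CoeffModule ℂ n K lam) (q + 1)) g c r) x‖ ≤ C * sz x ^ k := by
      intro g _ c r
      refine ⟨0, 0, fun x hx => ?_⟩
      simp only [zero_mul]
      rw [show ((0 : TwistedQuotient.Coch Γc (⊤ : Subgroup Γc) (ResGLnCone.hermSpace n K)
              (CoeffModule ℂ n K lam) (q + 1)) g c r) = fun _ => 0 from rfl, fderiv_const_apply]
      exact ⟨le_of_eq norm_zero, le_of_eq ContinuousLinearMap.opNorm_zero⟩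
    obtain ⟨βc, hβS, hβE, hβδ, hβd, hβb⟩ := stub_descent_growth (MonoidHom.id Γc) (⊤ : Subgroup Γc)
      ((coeffRepPos ℂ n K lam).comp Γc.subtype)
      (((ResGLnCone.coneActionRat n K).comp (glTotPos n K).subtype).comp Γc.subtype) hψ hXo hmaps
      sz hF' (fun x hx => hsz1 x hx.1) Δ hΔ hψb' κ q hS hEq hTow hD0 hκb 0 h0S h0E h0δ h0d h0b
    have hΔne : Δ.Nonempty := by
      obtain ⟨γ, t, ht, hred⟩ := hcov _ (ResGLnCone.hermOne_mem_posCone n K)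
      have hH'pos : (((ResGLnCone.coneActionRat n K).comp (glTotPos n K).subtype).comp Γc.subtype) γ⁻¹
          (ResGLnCone.hermOne n K) ∈ ResGLnCone.posCone n K := hmaps γ⁻¹ (ResGLnCone.hermOne_mem_posCone n K)
      have hH'F : (((ResGLnCone.coneActionRat n K).comp (glTotPos n K).subtype).comp Γc.subtype) γ⁻¹
          (ResGLnCone.hermOne n K) ∈ {H : ResGLnCone.hermSpace n K | H ∈ ResGLnCone.posCone n K ∧ ∃ t ∈ T,
            SiegelFamily.IsReduced c₀ C₀ τ₀ n (SiegelFamily.placeFamily K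
              ((ResGLnCone.coneActionRat n K t⁻¹ H : ResGLnCone.hermSpace n K) :
                Matrix (Fin n) (Fin n) (mixedSpace K)))} := by
        refine ⟨hH'pos, t, ht, ?_⟩
        have hcomp : ResGLnCone.coneActionRat n K t⁻¹
            ((((ResGLnCone.coneActionRat n K).comp (glTotPos n K).subtype).comp Γc.subtype) γ⁻¹
              (ResGLnCone.hermOne n K)) =
            ResGLnCone.coneActionRat n K (((γ : glTotPos n K) : GL (Fin n) K) * t)⁻¹ (ResGLnCone.hermOne n K) := by
          simp only [MonoidHom.comp_apply, Subgroup.coe_subtype, map_inv, mul_inv_rev, map_mul]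
          rfl
        rw [hcomp]
        exact hred
      by_contra hem; rw [Finset.not_nonempty_iff_eq_empty] at hem
      have hzero : ∀ γ' : Γc, ψ ((((ResGLnCone.coneActionRat n K).comp (glTotPos n K).subtype).comp Γc.subtype) γ'⁻¹
          ((((ResGLnCone.coneActionRat n K).comp (glTotPos n K).subtype).comp Γc.subtype) γ⁻¹
            (ResGLnCone.hermOne n K))) = 0 := fun γ' =>
        (hΔ γ' (by simp [hem]) _ hH'F).self_of_nhds
      have h1 : ∑ᶠ γ' : Γc, ψ ((((ResGLnCone.coneActionRat n K).comp (glTotPos n K).subtype).comp Γc.subtype) γ'⁻¹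
          ((((ResGLnCone.coneActionRat n K).comp (glTotPos n K).subtype).comp Γc.subtype) γ⁻¹
            (ResGLnCone.hermOne n K))) = 1 := hψ.sum_eq_one _ hH'pos
      rw [finsum_eq_zero_of_forall_eq_zero hzero] at h1; exact zero_ne_one h1
    obtain ⟨γ₀, hγ₀⟩ := hΔne
    haveI hsub : Subsingleton (Γc ⧸ (⊤ : Subgroup Γc)) := QuotientGroup.subsingleton_quotient_top
    obtain ⟨c1⟩ : Nonempty (Γc ⧸ (⊤ : Subgroup Γc)) := ⟨(1 : Γc)⟩
    obtain ⟨β₀, hβ₀⟩ : ∃ β₀ : ResGLnCone.hermSpace n K →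
        (ResGLnCone.hermSpace n K [⋀^Fin q]→L[ℝ] CoeffModule ℂ n K lam), β₀ = βc (fun _ => γ₀) c1 q := ⟨_, rfl⟩
    have hβconst : ∀ (g : Fin 1 → Γc) (c : Γc ⧸ (⊤ : Subgroup Γc)), ∀ x ∈ ResGLnCone.posCone n K,
        βc g c q x = βc (fun _ => γ₀) c q x := by
      intro g c x hx
      have h := hβδ (Matrix.vecCons (g 0) (fun _ => γ₀)) c q x hx
      rw [TwistedQuotient.delta_apply, Fin.sum_univ_two] at h
      have hg : (fun j : Fin 1 => Matrix.vecCons (g 0) (fun _ : Fin 1 => γ₀) ((1 : Fin 2).succAbove j)) = g := by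
        funext j; fin_cases j; rfl
      have hg' : (fun j : Fin 1 => Matrix.vecCons (g 0) (fun _ : Fin 1 => γ₀) ((0 : Fin 2).succAbove j)) =
          fun _ : Fin 1 => γ₀ := by
        funext j; fin_cases j; rfl
      simp only [hg, hg', Fin.val_zero, pow_zero, one_smul, Fin.val_one, pow_one, neg_smul,
        Pi.add_apply, Pi.neg_apply] at h
      exact (sub_eq_zero.1 (by rw [sub_eq_add_neg]; exact h)).symm
    have hβ₀s : ContDiffOn ℝ ((⊤ : ℕ∞) : WithTop ℕ∞) β₀ (ResGLnCone.posCone n K) := by rw [hβ₀]; exact hβS _ _ _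
    have hβ₀i : ∀ (γ : Γc), ∀ x ∈ ResGLnCone.posCone n K,
        TwistedQuotient.actAlt ((coeffRepPos ℂ n K lam).comp Γc.subtype)
          (((ResGLnCone.coneActionRat n K).comp (glTotPos n K).subtype).comp Γc.subtype) γ q
          (β₀ ((((ResGLnCone.coneActionRat n K).comp (glTotPos n K).subtype).comp Γc.subtype) γ⁻¹ x)) = β₀ x := by
      intro γ x hx
      have h := hβE γ (fun _ => γ₀) c1 q x hx
      rw [TwistedQuotient.famAct_eq_actAlt, Subsingleton.elim (((MonoidHom.id Γc) γ)⁻¹ • c1) c1] at h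
      subst hβ₀
      exact h.symm.trans (hβconst _ c1 x hx)
    have hβ₀d : ∀ x ∈ ResGLnCone.posCone n K, extDeriv β₀ x =
        @id (ResGLnCone.hermSpace n K [⋀^Fin (q + 1)]→L[ℝ] CoeffModule ℂ n K lam)
          (ConeDictionary.coneForm π.1 S lam η cL.out x) := by
      intro x hx
      have h := hβd (fun _ => γ₀) c1 (q + 1) x hx
      rw [TwistedQuotient.cochD_apply, TwistedQuotient.famD_succ] at h
      rw [hβ₀, h]; exact hDω _ c1 x hx
    have hβ₀b : ∃ (C : ℝ) (k : ℕ), ∀ x ∈ {H : ResGLnCone.hermSpace n K | H ∈ ResGLnCone.posCone n K ∧ ∃ t ∈ T,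
          SiegelFamily.IsReduced c₀ C₀ τ₀ n (SiegelFamily.placeFamily K
            ((ResGLnCone.coneActionRat n K t⁻¹ H : ResGLnCone.hermSpace n K) :
              Matrix (Fin n) (Fin n) (mixedSpace K)))},
        ‖β₀ x‖ ≤ C * (1 + ∑ i, ∑ j,
              (‖(x : Matrix (Fin n) (Fin n) (mixedSpace K)) i j‖ +
                ‖(x : Matrix (Fin n) (Fin n) (mixedSpace K))⁻¹ i j‖)) ^ k ∧
        ‖fderiv ℝ β₀ x‖ ≤ C * (1 + ∑ i, ∑ j,
              (‖(x : Matrix (Fin n) (Fin n) (mixedSpace K)) i j‖ +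
                ‖(x : Matrix (Fin n) (Fin n) (mixedSpace K))⁻¹ i j‖)) ^ k := by
      obtain ⟨C, k, h⟩ := hβb (fun _ => γ₀) (fun _ => hγ₀) c1 q
      refine ⟨|C| * Ccv ^ k, kcv * k, fun x hx => ?_⟩
      obtain ⟨h1, h2⟩ := h x hx
      obtain ⟨-, hS⟩ := hconv x hx.1
      have hs0 : 0 ≤ sz x := zero_le_one.trans (hsz1 x hx.1)
      have key : C * sz x ^ k ≤ |C| * Ccv ^ k * (1 + ∑ i, ∑ j,
          (‖(x : Matrix (Fin n) (Fin n) (mixedSpace K)) i j‖ +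
            ‖(x : Matrix (Fin n) (Fin n) (mixedSpace K))⁻¹ i j‖)) ^ (kcv * k) := by
        calc _ ≤ |C| * sz x ^ k := mul_le_mul_of_nonneg_right (le_abs_self _) (pow_nonneg hs0 _)
          _ ≤ |C| * (Ccv * (1 + ∑ i, ∑ j,
              (‖(x : Matrix (Fin n) (Fin n) (mixedSpace K)) i j‖ +
                ‖(x : Matrix (Fin n) (Fin n) (mixedSpace K))⁻¹ i j‖)) ^ kcv) ^ k :=
              mul_le_mul_of_nonneg_left (pow_le_pow_left₀ hs0 hS k) (abs_nonneg _)
          _ = _ := by rw [mul_pow, ← pow_mul]; ring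
      rw [hβ₀] at *
      exact ⟨h1.trans key, h2.trans key⟩
    exact stub_fam_ba hn hcpt 𝔫 π S lam hdom hη hZ hω cL hωs Γc hΓc T c₀ C₀ τ₀ hc₀ hC₀ hτ₀ hcov
      β₀ hβ₀s hβ₀i hβ₀d hβ₀b
  choose β₂ hβ₂ using percoset
  exact stub_fam_ext hcpt 𝔫 π S lam hη hω β₂ hβ₂

end Summit.Langlands.Langlands.Theorems.HeckeEigenvalueField.Res

end
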